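/-
Copyright (c) 2026. All rights reserved.
Released under Apache 2.0 license as described in the file LICENSE.
-/
import Literature.Geometry.Kaehler.ComplexTorusQuaternionXSixEichlerClassNumberFormula
import Literature.Geometry.Kaehler.ComplexTorusQuaternionXSixSpecialCyclesPrimitiveDegrees
import Mathlib.NumberTheory.LegendreSymbol.ZModChar
import HarnessLib

/-!
# The primitive cycles `Z_prim(m)` of `X₆` in closed form: `P(m) = 0 ⟺ 4 ∣ m ∨ 9 ∣ m ∨ χ₈(D_m) = 1 ∨ (D_m∕3) = 1`,
# `deg Z_prim(m)_ℚ = 2·h(D_m)·m₂·m₃ / w_m`, and new values `P(13) = 4`, `P(49) = 8`, `P(7) = 0`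

Tenth file of the Eichler-count plan. `…XSixEichlerClassNumberFormula.card_primitive_classes_closed_form` gave, for every
`m > 0`, `P(m) = |L_prim(m)/O₆^×| = h(D_m)·[4 ∤ m](1 − χ₈(D_m))·[9 ∤ m](1 − (D_m∕3))` (`D_m = −m` if `m ≡ 3 (mod 4)`,
else `−4m`); `…XSixSpecialCyclesPrimitiveDegrees.finsum_primitive_eq_card_div` gave `Σᶠ_{L_prim(m)/O₆^×} e⁻¹ = P(m)/w_m`
(`w_1 = 4`, `w_3 = 6`, else `2`). Consequences:

* §1 **`card_primitive_classes_eq_zero_iff`**: `P(m) = 0 ⟺ 4 ∣ m ∨ 9 ∣ m ∨ χ₈(D_m) = 1 ∨ (D_m∕3) = 1` (an optimal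
  embedding of `S_m` into `O₆` exists iff `S_m` is maximal at `2` and `3` and neither prime splits in `ℚ(√−m)`), and
  `card_primitive_classes_pos_iff`.
* §2 **`degree_primitive_closed_form`**: `2·Σᶠ_{L_prim(m)/O₆^×} e⁻¹ = 2·h(D_m)·[4∤m](1 − χ₈(D_m))·[9∤m](1 − (D_m∕3)) / w_m`.
* §3 values by kernel evaluation: `P(13) = 4` (`h(−52) = 2`), `P(49) = 8` (`h(−196) = 4`, `(−196∕3) = −1`), `P(7) = 0`
  (`−7 ≡ 1 (mod 8)`: `2` splits).

## Sources

* M. Eichler (1955), Satz 5; M.-F. Vignéras, LNM 800 (1980), Ch. III §5 Thm. 5.11, Cor. 5.12, Ch. II §3.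
  [cite: Eichler1955, Satz 5] [cite: VignerasLNM800, Ch. III §5 Thm. 5.11, Cor. 5.12; Ch. II §3]
* S. Kudla, M. Rapoport, T. Yang (2006), §3.4 (3.4.6), Remark 3.4.7, Prop. 3.4.5. [cite: KudlaRapoportYang2006, §3.4 (3.4.6), Remark 3.4.7]
* D. A. Cox (2013), Thm. 2.8, §7.D. [cite: Cox2013, Thm. 2.8, §7.D]

## Scope (honest)

Theorems only — no definition, no named fact, no instance.
-/

set_option maxSynthPendingDepth 3

open Quaternion Function
open scoped Pointwise
open Literature.NumberTheory.Automorphic Literature.NumberTheory.Automorphic.Brandt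
open Literature.NumberTheory.Automorphic.HeckeTraceFormulaGL2Level (ellipticConductors)
open Literature.NumberTheory.QuadraticFields.Quadratic (BinQF.classNumber BinQF.classNumber_pos)

namespace Literature.Geometry.Kaehler.ComplexTorus.QuaternionType

/-! ## §1 When is `P(m) = 0`? -/

section Vanishing

/-- `χ₈` takes the values `0, ±1`. [folklore] -/
private theorem χ₈_trichotomy₆₉ (x : ZMod 8) : ZMod.χ₈ x = 0 ∨ ZMod.χ₈ x = 1 ∨ ZMod.χ₈ x = -1 := by
  revert x; decide

/-- `(a∕3)` takes the values `0, ±1`. [folklore] -/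
private theorem legendreSym_three_trichotomy₆₉ (a : ℤ) :
    legendreSym 3 a = 0 ∨ legendreSym 3 a = 1 ∨ legendreSym 3 a = -1 := by
  rw [legendreSym]
  generalize (a : ZMod 3) = b
  revert b; decide

/-- `h(D_m) ≥ 1`. [cite: Cox2013, Thm. 2.8] -/
theorem classNumber_discf₁_pos {m : ℕ} (hm : 0 < m) : 0 < BinQF.classNumber (if (m : ℤ) % 4 = 3 then -(m : ℤ) else -4 * m) := by
  apply BinQF.classNumber_pos
  · split_ifs <;> omega
  · split_ifs <;> omega

/-- **`P(m) > 0 ⟺ 4 ∤ m ∧ 9 ∤ m ∧ χ₈(D_m) ≠ 1 ∧ (D_m∕3) ≠ 1`**: there is an optimal embedding `S_m ↪ O₆` iff `S_m` is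
maximal at the ramified primes `2, 3` and neither of them splits in `ℚ(√−m)`. [cite: VignerasLNM800, Ch. III §5 Cor. 5.12; Ch. II §3] [cite: KudlaRapoportYang2006, §3.4 Prop. 3.4.5 and Remark 3.4.7] -/
theorem card_primitive_classes_pos_iff {m : ℕ} (hm : 0 < m) :
    0 < Nat.card (Quot (fun x y : {x : ℤ × ℤ × ℤ // x.1 ^ 2 - 3 * x.2.1 ^ 2 - 3 * x.2.2 ^ 2 = (m : ℤ) ∧
      ∃ u : ℤ × ℤ × ℤ, u.1 * x.1 + u.2.1 * x.2.1 + u.2.2 * x.2.2 = 1} ↦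
      ∃ v : ℍ[ℚ,((-1 : ℤ) : ℚ),((3 : ℤ) : ℚ)], (v ∈ order (-1) 3 ∨ v - ⟨1/2, 1/2, 1/2, -1/2⟩ ∈ order (-1) 3) ∧
        ((v * star v).re = 1 ∨ (v * star v).re = -1) ∧
        v * ⟨0, x.1.1, x.1.2.1, x.1.2.2⟩ = ⟨0, y.1.1, y.1.2.1, y.1.2.2⟩ * v)) ↔
      ¬ 4 ∣ m ∧ ¬ 9 ∣ m ∧ ZMod.χ₈ ((((if (m : ℤ) % 4 = 3 then -(m : ℤ) else -4 * m) : ℤ)) : ZMod 8) ≠ 1 ∧ legendreSym 3 (if (m : ℤ) % 4 = 3 then -(m : ℤ) else -4 * m) ≠ 1 := by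
  have h := card_primitive_classes_closed_form hm
  have hh : (0 : ℤ) < BinQF.classNumber (if (m : ℤ) % 4 = 3 then -(m : ℤ) else -4 * m) := by exact_mod_cast classNumber_discf₁_pos hm
  constructor
  · intro hpos
    have hne : (Nat.card (Quot (fun x y : {x : ℤ × ℤ × ℤ // x.1 ^ 2 - 3 * x.2.1 ^ 2 - 3 * x.2.2 ^ 2 = (m : ℤ) ∧
      ∃ u : ℤ × ℤ × ℤ, u.1 * x.1 + u.2.1 * x.2.1 + u.2.2 * x.2.2 = 1} ↦
      ∃ v : ℍ[ℚ,((-1 : ℤ) : ℚ),((3 : ℤ) : ℚ)], (v ∈ order (-1) 3 ∨ v - ⟨1/2, 1/2, 1/2, -1/2⟩ ∈ order (-1) 3) ∧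
        ((v * star v).re = 1 ∨ (v * star v).re = -1) ∧
        v * ⟨0, x.1.1, x.1.2.1, x.1.2.2⟩ = ⟨0, y.1.1, y.1.2.1, y.1.2.2⟩ * v)) : ℤ) ≠ 0 := by exact_mod_cast hpos.ne'
    rw [h] at hne
    refine ⟨fun h4 => hne ?_, fun h9 => hne ?_, fun h2 => hne ?_, fun h3 => hne ?_⟩
    · rw [if_pos h4]; ring
    · rw [if_pos h9]; ring
    · by_cases h4 : 4 ∣ m
      · rw [if_pos h4]; ring
      · rw [if_neg h4, h2]; ring
    · by_cases h9 : 9 ∣ m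
      · rw [if_pos h9]; ring
      · rw [if_neg h9, h3]; ring
  · rintro ⟨h4, h9, h2, h3⟩
    have hδ2 : (0 : ℤ) < (if 4 ∣ m then 0 else 1 - ZMod.χ₈ ((((if (m : ℤ) % 4 = 3 then -(m : ℤ) else -4 * m) : ℤ)) : ZMod 8)) := by
      rw [if_neg h4]
      rcases χ₈_trichotomy₆₉ ((((if (m : ℤ) % 4 = 3 then -(m : ℤ) else -4 * m) : ℤ)) : ZMod 8) with e | e | e
      · rw [e]; norm_num
      · exact absurd e h2
      · rw [e]; norm_num
    have hδ3 : (0 : ℤ) < (if 9 ∣ m then 0 else 1 - legendreSym 3 (if (m : ℤ) % 4 = 3 then -(m : ℤ) else -4 * m)) := by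
      rw [if_neg h9]
      rcases legendreSym_three_trichotomy₆₉ (if (m : ℤ) % 4 = 3 then -(m : ℤ) else -4 * m) with e | e | e
      · rw [e]; norm_num
      · exact absurd e h3
      · rw [e]; norm_num
    have : (0 : ℤ) < (Nat.card (Quot (fun x y : {x : ℤ × ℤ × ℤ // x.1 ^ 2 - 3 * x.2.1 ^ 2 - 3 * x.2.2 ^ 2 = (m : ℤ) ∧
      ∃ u : ℤ × ℤ × ℤ, u.1 * x.1 + u.2.1 * x.2.1 + u.2.2 * x.2.2 = 1} ↦
      ∃ v : ℍ[ℚ,((-1 : ℤ) : ℚ),((3 : ℤ) : ℚ)], (v ∈ order (-1) 3 ∨ v - ⟨1/2, 1/2, 1/2, -1/2⟩ ∈ order (-1) 3) ∧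
        ((v * star v).re = 1 ∨ (v * star v).re = -1) ∧
        v * ⟨0, x.1.1, x.1.2.1, x.1.2.2⟩ = ⟨0, y.1.1, y.1.2.1, y.1.2.2⟩ * v)) : ℤ) := by
      rw [h]; exact mul_pos hh (mul_pos hδ2 hδ3)
    exact_mod_cast this

/-- **`P(m) = 0 ⟺ 4 ∣ m ∨ 9 ∣ m ∨ χ₈(D_m) = 1 ∨ (D_m∕3) = 1`.** [cite: VignerasLNM800, Ch. III §5 Cor. 5.12; Ch. II §3] [cite: KudlaRapoportYang2006, §3.4 Prop. 3.4.5 and Remark 3.4.7] -/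
theorem card_primitive_classes_eq_zero_iff {m : ℕ} (hm : 0 < m) :
    Nat.card (Quot (fun x y : {x : ℤ × ℤ × ℤ // x.1 ^ 2 - 3 * x.2.1 ^ 2 - 3 * x.2.2 ^ 2 = (m : ℤ) ∧
      ∃ u : ℤ × ℤ × ℤ, u.1 * x.1 + u.2.1 * x.2.1 + u.2.2 * x.2.2 = 1} ↦
      ∃ v : ℍ[ℚ,((-1 : ℤ) : ℚ),((3 : ℤ) : ℚ)], (v ∈ order (-1) 3 ∨ v - ⟨1/2, 1/2, 1/2, -1/2⟩ ∈ order (-1) 3) ∧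
        ((v * star v).re = 1 ∨ (v * star v).re = -1) ∧
        v * ⟨0, x.1.1, x.1.2.1, x.1.2.2⟩ = ⟨0, y.1.1, y.1.2.1, y.1.2.2⟩ * v)) = 0 ↔
      4 ∣ m ∨ 9 ∣ m ∨ ZMod.χ₈ ((((if (m : ℤ) % 4 = 3 then -(m : ℤ) else -4 * m) : ℤ)) : ZMod 8) = 1 ∨ legendreSym 3 (if (m : ℤ) % 4 = 3 then -(m : ℤ) else -4 * m) = 1 := by
  have h := card_primitive_classes_pos_iff hm
  constructor
  · intro h0
    rw [h0, lt_self_iff_false, false_iff] at h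
    by_contra hc
    apply h
    refine ⟨fun h4 => hc (Or.inl h4), fun h9 => hc (Or.inr (Or.inl h9)), fun h2 => hc (Or.inr (Or.inr (Or.inl h2))),
      fun h3 => hc (Or.inr (Or.inr (Or.inr h3)))⟩
  · intro hc
    by_contra h0
    obtain ⟨h4, h9, h2, h3⟩ := h.mp (Nat.pos_of_ne_zero h0)
    rcases hc with c | c | c | c
    · exact h4 c
    · exact h9 c
    · exact h2 c
    · exact h3 c

end Vanishing

/-! ## §2 `deg Z_prim(m)_ℚ` in closed form -/

section Degree

/-- **`deg Z_prim(m)_ℚ = 2·Σᶠ_{L_prim(m)/O₆^×} e⁻¹ = 2·h(D_m)·[4∤m](1 − χ₈(D_m))·[9∤m](1 − (D_m∕3)) / w_m`** for every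
`m > 0` (`w_1 = 4`, `w_3 = 6`, else `2`): the degree of the primitive cycle of norm `m`, KRY's term `c` with
`t/c² = m` of (3.4.6), in closed form. [cite: KudlaRapoportYang2006, §3.4 (3.4.6) and (3.4.14)] [cite: Eichler1955, Satz 5] -/
theorem degree_primitive_closed_form {m : ℕ} (hm : 0 < m) :
    2 * ∑ᶠ q : (Quot (fun x y : {x : ℤ × ℤ × ℤ // x.1 ^ 2 - 3 * x.2.1 ^ 2 - 3 * x.2.2 ^ 2 = (m : ℤ) ∧
      ∃ u : ℤ × ℤ × ℤ, u.1 * x.1 + u.2.1 * x.2.1 + u.2.2 * x.2.2 = 1} ↦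
      ∃ v : ℍ[ℚ,((-1 : ℤ) : ℚ),((3 : ℤ) : ℚ)], (v ∈ order (-1) 3 ∨ v - ⟨1/2, 1/2, 1/2, -1/2⟩ ∈ order (-1) 3) ∧
        ((v * star v).re = 1 ∨ (v * star v).re = -1) ∧
        v * ⟨0, x.1.1, x.1.2.1, x.1.2.2⟩ = ⟨0, y.1.1, y.1.2.1, y.1.2.2⟩ * v)),
        ((Nat.card
          {u : ℍ[ℚ,((-1 : ℤ) : ℚ),((3 : ℤ) : ℚ)] // (u ∈ order (-1) 3 ∨ u - ⟨1/2, 1/2, 1/2, -1/2⟩ ∈ order (-1) 3) ∧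
            ((u * star u).re = 1 ∨ (u * star u).re = -1) ∧
            u * ⟨0, q.out.1.1, q.out.1.2.1, q.out.1.2.2⟩ = ⟨0, q.out.1.1, q.out.1.2.1, q.out.1.2.2⟩ * u} : ℚ))⁻¹ =
      2 * ((BinQF.classNumber (if (m : ℤ) % 4 = 3 then -(m : ℤ) else -4 * m) * ((if 4 ∣ m then 0 else 1 - ZMod.χ₈ ((((if (m : ℤ) % 4 = 3 then -(m : ℤ) else -4 * m) : ℤ)) : ZMod 8)) * (if 9 ∣ m then 0 else 1 - legendreSym 3 (if (m : ℤ) % 4 = 3 then -(m : ℤ) else -4 * m))) : ℤ) : ℚ) / (if (m : ℤ) = 1 then (4 : ℚ) else if (m : ℤ) = 3 then 6 else 2) := by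
  rw [finsum_primitive_eq_card_div (by exact_mod_cast hm : (0 : ℤ) < m)]
  have h := card_primitive_classes_closed_form hm
  have h' : (Nat.card (Quot (fun x y : {x : ℤ × ℤ × ℤ // x.1 ^ 2 - 3 * x.2.1 ^ 2 - 3 * x.2.2 ^ 2 = (m : ℤ) ∧
      ∃ u : ℤ × ℤ × ℤ, u.1 * x.1 + u.2.1 * x.2.1 + u.2.2 * x.2.2 = 1} ↦
      ∃ v : ℍ[ℚ,((-1 : ℤ) : ℚ),((3 : ℤ) : ℚ)], (v ∈ order (-1) 3 ∨ v - ⟨1/2, 1/2, 1/2, -1/2⟩ ∈ order (-1) 3) ∧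
        ((v * star v).re = 1 ∨ (v * star v).re = -1) ∧
        v * ⟨0, x.1.1, x.1.2.1, x.1.2.2⟩ = ⟨0, y.1.1, y.1.2.1, y.1.2.2⟩ * v)) : ℚ) = ((BinQF.classNumber (if (m : ℤ) % 4 = 3 then -(m : ℤ) else -4 * m) * ((if 4 ∣ m then 0 else 1 - ZMod.χ₈ ((((if (m : ℤ) % 4 = 3 then -(m : ℤ) else -4 * m) : ℤ)) : ZMod 8)) * (if 9 ∣ m then 0 else 1 - legendreSym 3 (if (m : ℤ) % 4 = 3 then -(m : ℤ) else -4 * m))) : ℤ) : ℚ) := by exact_mod_cast h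
  rw [h', mul_div_assoc]

end Degree

/-! ## §3 Values -/

section Values

/-- **`P(13) = 4`** (`D = −52`, `h(−52) = 2`, `χ₈(−52) = 0`, `(−52∕3) = −1`; all of `L(13)` is primitive, `13` squarefree,
matching the series' `|L(13)/O₆^×| = 4`). [cite: KudlaRapoportYang2006, §3.4 (3.4.6)] -/
theorem card_primitive_thirteen : (Nat.card (Quot (fun x y : {x : ℤ × ℤ × ℤ // x.1 ^ 2 - 3 * x.2.1 ^ 2 - 3 * x.2.2 ^ 2 = (13 : ℤ) ∧
      ∃ u : ℤ × ℤ × ℤ, u.1 * x.1 + u.2.1 * x.2.1 + u.2.2 * x.2.2 = 1} ↦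
      ∃ v : ℍ[ℚ,((-1 : ℤ) : ℚ),((3 : ℤ) : ℚ)], (v ∈ order (-1) 3 ∨ v - ⟨1/2, 1/2, 1/2, -1/2⟩ ∈ order (-1) 3) ∧
        ((v * star v).re = 1 ∨ (v * star v).re = -1) ∧
        v * ⟨0, x.1.1, x.1.2.1, x.1.2.2⟩ = ⟨0, y.1.1, y.1.2.1, y.1.2.2⟩ * v)) : ℤ) = 4 := by
  have e : (Nat.card (Quot (fun x y : {x : ℤ × ℤ × ℤ // x.1 ^ 2 - 3 * x.2.1 ^ 2 - 3 * x.2.2 ^ 2 = (13 : ℤ) ∧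
      ∃ u : ℤ × ℤ × ℤ, u.1 * x.1 + u.2.1 * x.2.1 + u.2.2 * x.2.2 = 1} ↦
      ∃ v : ℍ[ℚ,((-1 : ℤ) : ℚ),((3 : ℤ) : ℚ)], (v ∈ order (-1) 3 ∨ v - ⟨1/2, 1/2, 1/2, -1/2⟩ ∈ order (-1) 3) ∧
        ((v * star v).re = 1 ∨ (v * star v).re = -1) ∧
        v * ⟨0, x.1.1, x.1.2.1, x.1.2.2⟩ = ⟨0, y.1.1, y.1.2.1, y.1.2.2⟩ * v)) : ℤ) = Nat.card (Quot (fun x y : {x : ℤ × ℤ × ℤ // x.1 ^ 2 - 3 * x.2.1 ^ 2 - 3 * x.2.2 ^ 2 = ((13 : ℕ) : ℤ) ∧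
      ∃ u : ℤ × ℤ × ℤ, u.1 * x.1 + u.2.1 * x.2.1 + u.2.2 * x.2.2 = 1} ↦
      ∃ v : ℍ[ℚ,((-1 : ℤ) : ℚ),((3 : ℤ) : ℚ)], (v ∈ order (-1) 3 ∨ v - ⟨1/2, 1/2, 1/2, -1/2⟩ ∈ order (-1) 3) ∧
        ((v * star v).re = 1 ∨ (v * star v).re = -1) ∧
        v * ⟨0, x.1.1, x.1.2.1, x.1.2.2⟩ = ⟨0, y.1.1, y.1.2.1, y.1.2.2⟩ * v)) := rfl
  rw [e, card_primitive_classes_closed_form (by norm_num : 0 < 13)]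
  decide +kernel

/-- **`P(49) = 8`** (new: `D = −196`, `h(−196) = 4`, `χ₈(−196) = 0`, `(−196∕3) = −1`; so
`|L(49)/O₆^×| = P(49) + P(1) = 10`). [cite: KudlaRapoportYang2006, §3.4 (3.4.6)] -/
theorem card_primitive_fortynine : (Nat.card (Quot (fun x y : {x : ℤ × ℤ × ℤ // x.1 ^ 2 - 3 * x.2.1 ^ 2 - 3 * x.2.2 ^ 2 = (49 : ℤ) ∧
      ∃ u : ℤ × ℤ × ℤ, u.1 * x.1 + u.2.1 * x.2.1 + u.2.2 * x.2.2 = 1} ↦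
      ∃ v : ℍ[ℚ,((-1 : ℤ) : ℚ),((3 : ℤ) : ℚ)], (v ∈ order (-1) 3 ∨ v - ⟨1/2, 1/2, 1/2, -1/2⟩ ∈ order (-1) 3) ∧
        ((v * star v).re = 1 ∨ (v * star v).re = -1) ∧
        v * ⟨0, x.1.1, x.1.2.1, x.1.2.2⟩ = ⟨0, y.1.1, y.1.2.1, y.1.2.2⟩ * v)) : ℤ) = 8 := by
  have e : (Nat.card (Quot (fun x y : {x : ℤ × ℤ × ℤ // x.1 ^ 2 - 3 * x.2.1 ^ 2 - 3 * x.2.2 ^ 2 = (49 : ℤ) ∧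
      ∃ u : ℤ × ℤ × ℤ, u.1 * x.1 + u.2.1 * x.2.1 + u.2.2 * x.2.2 = 1} ↦
      ∃ v : ℍ[ℚ,((-1 : ℤ) : ℚ),((3 : ℤ) : ℚ)], (v ∈ order (-1) 3 ∨ v - ⟨1/2, 1/2, 1/2, -1/2⟩ ∈ order (-1) 3) ∧
        ((v * star v).re = 1 ∨ (v * star v).re = -1) ∧
        v * ⟨0, x.1.1, x.1.2.1, x.1.2.2⟩ = ⟨0, y.1.1, y.1.2.1, y.1.2.2⟩ * v)) : ℤ) = Nat.card (Quot (fun x y : {x : ℤ × ℤ × ℤ // x.1 ^ 2 - 3 * x.2.1 ^ 2 - 3 * x.2.2 ^ 2 = ((49 : ℕ) : ℤ) ∧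
      ∃ u : ℤ × ℤ × ℤ, u.1 * x.1 + u.2.1 * x.2.1 + u.2.2 * x.2.2 = 1} ↦
      ∃ v : ℍ[ℚ,((-1 : ℤ) : ℚ),((3 : ℤ) : ℚ)], (v ∈ order (-1) 3 ∨ v - ⟨1/2, 1/2, 1/2, -1/2⟩ ∈ order (-1) 3) ∧
        ((v * star v).re = 1 ∨ (v * star v).re = -1) ∧
        v * ⟨0, x.1.1, x.1.2.1, x.1.2.2⟩ = ⟨0, y.1.1, y.1.2.1, y.1.2.2⟩ * v)) := rfl
  rw [e, card_primitive_classes_closed_form (by norm_num : 0 < 49)]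
  decide +kernel

/-- **`P(7) = 0`** (`D = −7 ≡ 1 (mod 8)`: `2` splits in `ℚ(√−7)`, no optimal embedding; the series'
`card_normOne_classes_two_and_seven`). [cite: KudlaRapoportYang2006, §3.4 Prop. 3.4.5] -/
theorem card_primitive_seven : Nat.card (Quot (fun x y : {x : ℤ × ℤ × ℤ // x.1 ^ 2 - 3 * x.2.1 ^ 2 - 3 * x.2.2 ^ 2 = (7 : ℤ) ∧
      ∃ u : ℤ × ℤ × ℤ, u.1 * x.1 + u.2.1 * x.2.1 + u.2.2 * x.2.2 = 1} ↦
      ∃ v : ℍ[ℚ,((-1 : ℤ) : ℚ),((3 : ℤ) : ℚ)], (v ∈ order (-1) 3 ∨ v - ⟨1/2, 1/2, 1/2, -1/2⟩ ∈ order (-1) 3) ∧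
        ((v * star v).re = 1 ∨ (v * star v).re = -1) ∧
        v * ⟨0, x.1.1, x.1.2.1, x.1.2.2⟩ = ⟨0, y.1.1, y.1.2.1, y.1.2.2⟩ * v)) = 0 := by
  have e : (Nat.card (Quot (fun x y : {x : ℤ × ℤ × ℤ // x.1 ^ 2 - 3 * x.2.1 ^ 2 - 3 * x.2.2 ^ 2 = (7 : ℤ) ∧
      ∃ u : ℤ × ℤ × ℤ, u.1 * x.1 + u.2.1 * x.2.1 + u.2.2 * x.2.2 = 1} ↦
      ∃ v : ℍ[ℚ,((-1 : ℤ) : ℚ),((3 : ℤ) : ℚ)], (v ∈ order (-1) 3 ∨ v - ⟨1/2, 1/2, 1/2, -1/2⟩ ∈ order (-1) 3) ∧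
        ((v * star v).re = 1 ∨ (v * star v).re = -1) ∧
        v * ⟨0, x.1.1, x.1.2.1, x.1.2.2⟩ = ⟨0, y.1.1, y.1.2.1, y.1.2.2⟩ * v)) : ℤ) = Nat.card (Quot (fun x y : {x : ℤ × ℤ × ℤ // x.1 ^ 2 - 3 * x.2.1 ^ 2 - 3 * x.2.2 ^ 2 = ((7 : ℕ) : ℤ) ∧
      ∃ u : ℤ × ℤ × ℤ, u.1 * x.1 + u.2.1 * x.2.1 + u.2.2 * x.2.2 = 1} ↦
      ∃ v : ℍ[ℚ,((-1 : ℤ) : ℚ),((3 : ℤ) : ℚ)], (v ∈ order (-1) 3 ∨ v - ⟨1/2, 1/2, 1/2, -1/2⟩ ∈ order (-1) 3) ∧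
        ((v * star v).re = 1 ∨ (v * star v).re = -1) ∧
        v * ⟨0, x.1.1, x.1.2.1, x.1.2.2⟩ = ⟨0, y.1.1, y.1.2.1, y.1.2.2⟩ * v)) := rfl
  have h : (Nat.card (Quot (fun x y : {x : ℤ × ℤ × ℤ // x.1 ^ 2 - 3 * x.2.1 ^ 2 - 3 * x.2.2 ^ 2 = (7 : ℤ) ∧
      ∃ u : ℤ × ℤ × ℤ, u.1 * x.1 + u.2.1 * x.2.1 + u.2.2 * x.2.2 = 1} ↦
      ∃ v : ℍ[ℚ,((-1 : ℤ) : ℚ),((3 : ℤ) : ℚ)], (v ∈ order (-1) 3 ∨ v - ⟨1/2, 1/2, 1/2, -1/2⟩ ∈ order (-1) 3) ∧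
        ((v * star v).re = 1 ∨ (v * star v).re = -1) ∧
        v * ⟨0, x.1.1, x.1.2.1, x.1.2.2⟩ = ⟨0, y.1.1, y.1.2.1, y.1.2.2⟩ * v)) : ℤ) = 0 := by
    rw [e, card_primitive_classes_closed_form (by norm_num : 0 < 7)]
    decide +kernel
  exact_mod_cast h

end Values

end Literature.Geometry.Kaehler.ComplexTorus.QuaternionType
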